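import Literature.Computability.Cryptography.SISSolverKey
import Literature.Computability.Complexity.PairingMachines
import Literature.Computability.Complexity.RandomizedProofs
import Literature.Computability.Complexity.EncodingFrames
import HarnessLib

/-!
# The SIS′ solver is polynomial-time, III: the run map (discharge of `sisSolver_polyTime`)

Third file of the discharge of the named fact `Literature.Computability.Cryptography.sisSolver_polyTime`
(`SISFunctionSolver.lean`; the TM2-level leaf of `owfExist_of_gapSVP_worstCaseHard`, cf.
`owfExist_of_gapSVP_worstCaseHard_of_two` in `LatticeOWFProofs.lean`), continuing
`SISSolverParams.lean` (parameters) and `SISSolverKey.lean` (`keyFn = SIS.keyOf`). On the pair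
`⟨inp, r⟩` (instance, coins) the run `(SIS.sisSolver A cb).run inp r = SIS.solverCoreK A cb n (keyOf inp) r`,
`n = nOf inp`, `cb = p`, is assembled from `FP` string functions following its `let`s:

* `uU = 1ᵘ`, `u = ⟦r ↾ g⟧ mod blockLen n` (`Brick.remFn`, `binToUnaryFn` with the ruler
  `1^{blockLen n}`); `wF = keyOf inp ++ (r ⇂ g) ↾ m ++ (r ⇂ (g + m)) ↾ u` (`Plumb.takeFn`/`dropFn` with
  unary rulers); `yF = ⟨1^{|w|}, sisFunction w⟩` (the hypothesis `sisFunction ∈ FP`);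
* `LU = 1ᴸ`, `L = ⟦(r ⇂ (g + m + blockLen n)) ↾ lenBits⟧ mod (p |y| + 1)` (`bpolyFn`, `remFn`,
  `binToUnaryFn` with the ruler `1^{p |y| + 1}`); `coinsF = (r ⇂ (g + m + blockLen n + lenBits)) ↾ L`;
  `zF = A.run y coins` (the PPT hypothesis on `A`, read through `boolUnpair`);
* the output `encodeIntVec ⟨m, xOf n w - xOf n z⟩` by a counted loop (`outBody`, `outLoopFn`)
  appending, for `j < m`, the code `boolPair (code of [w_{nmt+j}] - [z_{nmt+j}]) ε` of the
  difference of two bits (`codeOf`, `itemF`; constant growth per round), framed as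
  `boolPair (encodeNat m) (boolPair (1ᵐ) ·)` (`finVec_encode_eq`, `frames_append` of `EncodingFrames.lean`).

Main results: `runFn_apply : runFn A p ⟨inp, r⟩ = (sisSolver A (p ·)).run inp r` on ALL strings,
`runFn_mem_FP`, and the discharge
`Literature.Computability.Cryptography.sisSolver_polyTime_holds : sisSolver_polyTime`
(transport along the pair presentation, `PolyTimeComputable.of_encode_eq`).

## References

* D. Micciancio, O. Regev, *Worst-case to average-case reductions based on Gaussian measures*,
  SIAM J. Comput. 37 (2007), §5.1 (the reduction: inverting `f_A` on the average gives SIS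
  solutions).
* M. Ajtai, *Generating hard instances of lattice problems*, STOC 1996, Thm. 1.
* S. Arora, B. Barak, *Computational Complexity: A Modern Approach*, CUP 2009, §1.3, Claim 1.6 /
  Thm. 2.8 (composition of polynomial-time computations), Def. 7.1 (probabilistic machines as
  deterministic machines with a random tape).
-/

noncomputable section

namespace Literature.Computability.Cryptography.SIS.SolverFP

open _root_.Computability Polynomial Literature.Computability.Complexity Brick Plumb HashBricks OracleCompose
open Literature.Algebra.EuclideanLattices (encodeIntVec)

variable (A : RandAlg (List Bool) (List Bool)) (p : Polynomial ℕ)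

/-! ### The fields of the pair `⟨inp, r⟩` and the parameters -/

/-- `1ⁿ` from the pair. [folklore] -/
def NF : List Bool → List Bool := nU ∘ fstP
/-- `1^{guessBits n}`. [folklore] -/
def GF : List Bool → List Bool := gU ∘ NF
/-- `1^{width n}`. [folklore] -/
def MF : List Bool → List Bool := mU ∘ NF
/-- `1^{blockLen n}`. [folklore] -/
def BLF : List Bool → List Bool := blU ∘ NF
/-- `1^{lenBits (p ·) n}`. [folklore] -/
def LBF : List Bool → List Bool := lbU p ∘ NF
/-- `1^{g + m}`. [folklore] -/
def GMF : List Bool → List Bool := concatFn ∘ fanoutFn GF MF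
/-- `1^{g + m + blockLen n}`. [folklore] -/
def GMBF : List Bool → List Bool := concatFn ∘ fanoutFn GMF BLF
/-- `1^{g + m + blockLen n + lenBits}`. [folklore] -/
def GMBLF : List Bool → List Bool := concatFn ∘ fanoutFn GMBF (LBF p)

section Values
variable (inp r : List Bool)

/-- Value of `NF`. [folklore] -/
@[simp] theorem NF_apply : NF (boolPair inp r) = ones (nOf inp) := by simp [NF]
/-- Value of `GF`. [folklore] -/
@[simp] theorem GF_apply : GF (boolPair inp r) = ones (guessBits (nOf inp)) := by simp [GF, ones]
/-- Value of `MF`. [folklore] -/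
@[simp] theorem MF_apply : MF (boolPair inp r) = ones (width (nOf inp)) := by simp [MF, ones]
/-- Value of `BLF`. [folklore] -/
@[simp] theorem BLF_apply : BLF (boolPair inp r) = ones (blockLen (nOf inp)) := by simp [BLF, ones]
/-- Value of `LBF`. [folklore] -/
@[simp] theorem LBF_apply : LBF p (boolPair inp r) = ones (lenBits (fun ℓ => p.eval ℓ) (nOf inp)) := by simp [LBF, ones]
/-- Value of `GMF`. [folklore] -/
@[simp] theorem GMF_apply : GMF (boolPair inp r) = ones (guessBits (nOf inp) + width (nOf inp)) := by
  simp [GMF, ones]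
/-- Value of `GMBF`. [folklore] -/
@[simp] theorem GMBF_apply :
    GMBF (boolPair inp r) = ones (guessBits (nOf inp) + width (nOf inp) + blockLen (nOf inp)) := by
  simp [GMBF, ones]
/-- Value of `GMBLF`. [folklore] -/
@[simp] theorem GMBLF_apply : GMBLF p (boolPair inp r) =
    ones (guessBits (nOf inp) + width (nOf inp) + blockLen (nOf inp) + lenBits (fun ℓ => p.eval ℓ) (nOf inp)) := by
  simp [GMBLF, ones]
end Values

/-- `NF ∈ FP`. [folklore] -/
theorem NF_mem_FP : NF ∈ FP := comp_mem_FP nU_mem_FP fstP_mem_FP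
/-- `GF ∈ FP`. [folklore] -/
theorem GF_mem_FP : GF ∈ FP := comp_mem_FP gU_mem_FP NF_mem_FP
/-- `MF ∈ FP`. [folklore] -/
theorem MF_mem_FP : MF ∈ FP := comp_mem_FP mU_mem_FP NF_mem_FP
/-- `BLF ∈ FP`. [folklore] -/
theorem BLF_mem_FP : BLF ∈ FP := comp_mem_FP blU_mem_FP NF_mem_FP
/-- `LBF p ∈ FP`. [folklore] -/
theorem LBF_mem_FP : LBF p ∈ FP := comp_mem_FP (lbU_mem_FP p) NF_mem_FP
/-- `GMF ∈ FP`. [folklore] -/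
theorem GMF_mem_FP : GMF ∈ FP := comp_mem_FP concatFn_mem_FP (fanoutFn_mem_FP GF_mem_FP MF_mem_FP)
/-- `GMBF ∈ FP`. [folklore] -/
theorem GMBF_mem_FP : GMBF ∈ FP := comp_mem_FP concatFn_mem_FP (fanoutFn_mem_FP GMF_mem_FP BLF_mem_FP)
/-- `GMBLF p ∈ FP`. [folklore] -/
theorem GMBLF_mem_FP : GMBLF p ∈ FP := comp_mem_FP concatFn_mem_FP (fanoutFn_mem_FP GMBF_mem_FP (LBF_mem_FP p))

/-! ### The guessed padding length `u`, the query `w` and the inverter's input `y` -/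

/-- `1ᵘ`, `u = ⟦r ↾ g⟧ mod blockLen n`: remainder in binary, then unary against the ruler
`1^{blockLen n}`. [folklore] -/
def uU : List Bool → List Bool :=
  binToUnaryFn ∘ fanoutFn BLF (remFn ∘ fanoutFn (takeFn ∘ fanoutFn GF sndP) (lenBinF ∘ BLF))

/-- Value of `uU`. [folklore] -/
theorem uU_apply (inp r : List Bool) :
    uU (boolPair inp r) = ones (Complexity.bitsToNat (r.take (guessBits (nOf inp))) % blockLen (nOf inp)) := by
  have hbl := one_le_blockLen (nOf inp)
  have hlt : Complexity.bitsToNat (r.take (guessBits (nOf inp))) % blockLen (nOf inp) < blockLen (nOf inp) :=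
    Nat.mod_lt _ hbl
  simp [uU, ones, min_eq_left hlt.le]

/-- `uU ∈ FP`. [folklore] -/
theorem uU_mem_FP : uU ∈ FP :=
  comp_mem_FP binToUnaryFn_mem_FP (fanoutFn_mem_FP BLF_mem_FP (comp_mem_FP remFn_mem_FP
    (fanoutFn_mem_FP (comp_mem_FP takeFn_mem_FP (fanoutFn_mem_FP GF_mem_FP sndP_mem_FP)) (comp_mem_FP lenBinF_mem_FP BLF_mem_FP))))

/-- The query `w = keyOf inp ++ ((r ⇂ g) ↾ m ++ (r ⇂ (g + m)) ↾ u)`. [folklore] -/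
def wF : List Bool → List Bool :=
  concatFn ∘ fanoutFn (keyFn ∘ fstP)
    (concatFn ∘ fanoutFn (takeFn ∘ fanoutFn MF (dropFn ∘ fanoutFn GF sndP))
      (takeFn ∘ fanoutFn uU (dropFn ∘ fanoutFn GMF sndP)))

/-- The query of the solver (the `w` of `SIS.solverCoreK`), as a function of `inp`, `r`. [folklore] -/
def queryOf (inp r : List Bool) : List Bool :=
  keyOf inp ++ (((r.drop (guessBits (nOf inp))).take (width (nOf inp))) ++
    ((r.drop (guessBits (nOf inp) + width (nOf inp))).take
      (Complexity.bitsToNat (r.take (guessBits (nOf inp))) % blockLen (nOf inp))))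

/-- Value of `wF`. [folklore] -/
theorem wF_apply (inp r : List Bool) : wF (boolPair inp r) = queryOf inp r := by
  simp [wF, queryOf, uU_apply, keyFn_apply, ones]

/-- `wF ∈ FP`. [folklore] -/
theorem wF_mem_FP : wF ∈ FP :=
  comp_mem_FP concatFn_mem_FP (fanoutFn_mem_FP (comp_mem_FP keyFn_mem_FP fstP_mem_FP)
    (comp_mem_FP concatFn_mem_FP (fanoutFn_mem_FP
      (comp_mem_FP takeFn_mem_FP (fanoutFn_mem_FP MF_mem_FP (comp_mem_FP dropFn_mem_FP (fanoutFn_mem_FP GF_mem_FP sndP_mem_FP))))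
      (comp_mem_FP takeFn_mem_FP (fanoutFn_mem_FP uU_mem_FP (comp_mem_FP dropFn_mem_FP (fanoutFn_mem_FP GMF_mem_FP sndP_mem_FP)))))))

/-- The inverter's input `y = ⟨1^{|w|}, sisFunction w⟩`. [folklore] -/
def yF : List Bool → List Bool := fanoutFn onesFn sisFunction ∘ wF

/-- Value of `yF`. [folklore] -/
theorem yF_apply (inp r : List Bool) :
    yF (boolPair inp r) = boolPair (unaryEncodeNat (queryOf inp r).length) (sisFunction (queryOf inp r)) := by
  simp [yF, wF_apply, onesFn]

/-- `yF ∈ FP` given that Ajtai's function is polynomial-time. [folklore] -/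
theorem yF_mem_FP (hf : sisFunction_polyTimeComputable) : yF ∈ FP :=
  comp_mem_FP (fanoutFn_mem_FP onesFn_mem_FP hf) wF_mem_FP

/-! ### The guessed coin count `L`, the coins and the inverter's answer -/

/-- `1ᴸ`, `L = ⟦(r ⇂ (g + m + blockLen n)) ↾ lenBits⟧ mod (p |y| + 1)`: the modulus in binary by
`bpolyFn`, the remainder by `remFn`, unary against the ruler `1^{p |y| + 1}`. [folklore] -/
def LU : List Bool → List Bool :=
  binToUnaryFn ∘ fanoutFn (polyFn (p + 1) ∘ yF)
    (remFn ∘ fanoutFn (takeFn ∘ fanoutFn (LBF p) (dropFn ∘ fanoutFn GMBF sndP))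
      (baddFn (bpolyFn p ∘ lenBinF ∘ yF) (bconst 1)))

/-- The guessed coin count (the `L` of `SIS.solverCoreK`). [folklore] -/
def coinCountOf (inp r : List Bool) : ℕ :=
  Complexity.bitsToNat ((r.drop (guessBits (nOf inp) + width (nOf inp) + blockLen (nOf inp))).take
      (lenBits (fun ℓ => p.eval ℓ) (nOf inp))) %
    (p.eval (boolPair (unaryEncodeNat (queryOf inp r).length) (sisFunction (queryOf inp r))).length + 1)

/-- Value of `LU`. [folklore] -/
theorem LU_apply (inp r : List Bool) : LU p (boolPair inp r) = ones (coinCountOf p inp r) := by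
  simp [LU, coinCountOf, yF_apply, bpolyFn, ones]
  exact (Nat.mod_lt _ (Nat.succ_pos _)).le

/-- `LU p ∈ FP`. [folklore] -/
theorem LU_mem_FP (hf : sisFunction_polyTimeComputable) : LU p ∈ FP :=
  comp_mem_FP binToUnaryFn_mem_FP (fanoutFn_mem_FP (comp_mem_FP (polyFn_mem_FP _) (yF_mem_FP hf))
    (comp_mem_FP remFn_mem_FP (fanoutFn_mem_FP
      (comp_mem_FP takeFn_mem_FP (fanoutFn_mem_FP (LBF_mem_FP p) (comp_mem_FP dropFn_mem_FP (fanoutFn_mem_FP GMBF_mem_FP sndP_mem_FP))))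
      (baddFn_mem_FP (comp_mem_FP (bpolyFn_mem_FP p) (comp_mem_FP lenBinF_mem_FP (yF_mem_FP hf))) (bconst_mem_FP 1)))))

/-- The inverter's coins `(r ⇂ (g + m + blockLen n + lenBits)) ↾ L`. [folklore] -/
def coinsF : List Bool → List Bool := takeFn ∘ fanoutFn (LU p) (dropFn ∘ fanoutFn (GMBLF p) sndP)

/-- Value of `coinsF`. [folklore] -/
theorem coinsF_apply (inp r : List Bool) : coinsF p (boolPair inp r) =
    (r.drop (guessBits (nOf inp) + width (nOf inp) + blockLen (nOf inp) + lenBits (fun ℓ => p.eval ℓ) (nOf inp))).take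
      (coinCountOf p inp r) := by
  simp [coinsF, LU_apply, ones]

/-- `coinsF p ∈ FP`. [folklore] -/
theorem coinsF_mem_FP (hf : sisFunction_polyTimeComputable) : coinsF p ∈ FP :=
  comp_mem_FP takeFn_mem_FP (fanoutFn_mem_FP (LU_mem_FP p hf) (comp_mem_FP dropFn_mem_FP (fanoutFn_mem_FP (GMBLF_mem_FP p) sndP_mem_FP)))

/-- The inverter's answer `z = A.run y coins`. [folklore] -/
def zF : List Bool → List Bool := (Function.uncurry A.run ∘ boolUnpair) ∘ fanoutFn yF (coinsF p)

/-- Value of `zF`. [folklore] -/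
theorem zF_apply (inp r : List Bool) : zF A p (boolPair inp r) =
    A.run (boolPair (unaryEncodeNat (queryOf inp r).length) (sisFunction (queryOf inp r)))
      ((r.drop (guessBits (nOf inp) + width (nOf inp) + blockLen (nOf inp) + lenBits (fun ℓ => p.eval ℓ) (nOf inp))).take
        (coinCountOf p inp r)) := by
  simp [zF, yF_apply, coinsF_apply]

/-- `zF A p ∈ FP`: the run map of the PPT `A` read through the pair decoder is in `FP`
(`PolyTimeComputable.comp_holds` with `polyTimeComputable_boolUnpair`; cf.
`RandAlg.uncurry_run_comp_boolUnpair_mem_FP` of `MetaComplexity/RandReductionsProofs.lean`, not imported). [cite: AroraBarakCC2009, Claim 1.6 (composition)] -/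
theorem zF_mem_FP (hf : sisFunction_polyTimeComputable) (hA : IsPPT A id) : zF A p ∈ FP :=
  comp_mem_FP (PolyTimeComputable.comp_holds hA.1 polyTimeComputable_boolUnpair)
    (fanoutFn_mem_FP (yF_mem_FP hf) (coinsF_mem_FP p hf))


/-! ### The output: the integer vector `xOf n w - xOf n z`, coded, by a counted loop -/

/-- The code of the difference `[wᵢ] - [zᵢ] ∈ {-1, 0, 1}` of two bits read by index (junk bits
`false` past the end, as `SIS.parseVec` reads them). [folklore] -/
def codeOf (w z : List Bool) (i : ℕ) : List Bool :=
  encodingIntBool.encode ((if w.getD i false then (1 : ℤ) else 0) - (if z.getD i false then (1 : ℤ) else 0))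

/-- The three codes: `0 ↦ ⟨[0], ε⟩`, `1 ↦ ⟨[0], [1]⟩`, `-1 ↦ ⟨[1], [1]⟩`. [folklore] -/
theorem codeOf_eq (w z : List Bool) (i : ℕ) : codeOf w z i =
    if w.getD i false = z.getD i false then boolPair [false] []
    else if w.getD i false then boolPair [false] [true] else boolPair [true] [true] := by
  unfold codeOf
  cases w.getD i false <;> cases z.getD i false <;> rfl

/-- **The output of `SIS.solverCoreK` as a flat string** (`finVec_encode_eq` of
`EncodingFrames.lean`): for `w, z` and the offset `n m t`,
`encodeIntVec ⟨m, xOf n w - xOf n z⟩ = ⟨encodeNat m, ⟨1ᵐ, frames of the codes⟩⟩`. [folklore] -/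
theorem encodeIntVec_xOf_sub (n : ℕ) (w z : List Bool) :
    encodeIntVec ⟨width n, xOf n w - xOf n z⟩ =
      boolPair (encodeNat (width n)) (boolPair (unaryEncodeNat (width n))
        (frames ((List.range (width n)).map fun j => codeOf w z (n * width n * bitWidth n + j)))) := by
  change boolPair (encodeNat (width n)) ((encodingFinVec encodingIntBool (width n)).encode (xOf n w - xOf n z)) = _
  rw [finVec_encode_eq, ← boolPair_eq, List.ofFn_eq_map, ← List.map_coe_finRange_eq_range, List.map_map]
  rfl

/-- The index `1^{off + j}` of the current bit: `off` is field `1` of the fixed field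
`X = ⟨1ᵐ, ⟨1^{off}, ⟨w, z⟩⟩⟩`, `1ʲ` is the state counter. [folklore] -/
def idxF : List Bool → List Bool := concatFn ∘ fanoutFn (nthF 1 ∘ nthF 0) (nthF 2)

/-- The current bit of `w` (one bit on every input). [folklore] -/
def bitWF : List Bool → List Bool := headBitFn ∘ dropFn ∘ fanoutFn idxF (nthF 2 ∘ nthF 0)

/-- The current bit of `z` (one bit on every input). [folklore] -/
def bitZF : List Bool → List Bool := headBitFn ∘ dropFn ∘ fanoutFn idxF (sndPow 2 ∘ nthF 0)

/-- The code of the current difference. [folklore] -/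
def itemF : List Bool → List Bool :=
  iteFn bitWF (iteFn bitZF (fun _ => boolPair [false] []) (fun _ => boolPair [false] [true]))
    (iteFn bitZF (fun _ => boolPair [true] [true]) (fun _ => boolPair [false] []))

/-- **One round of the output loop**: the new state `⟨1ʲ⁺¹, acc ++ ⟨code_j, ε⟩⟩`. [folklore] -/
def outBody : List Bool → List Bool :=
  fanoutFn (List.cons true ∘ nthF 2) (concatFn ∘ fanoutFn (sndPow 2) (fanoutFn itemF fun _ => []))

/-- `idxF ∈ FP`. [folklore] -/
theorem idxF_mem_FP : idxF ∈ FP :=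
  comp_mem_FP concatFn_mem_FP (fanoutFn_mem_FP (comp_mem_FP (nthF_mem_FP 1) (nthF_mem_FP 0)) (nthF_mem_FP 2))
/-- `bitWF ∈ FP`. [folklore] -/
theorem bitWF_mem_FP : bitWF ∈ FP :=
  comp_mem_FP headBitFn_mem_FP (comp_mem_FP dropFn_mem_FP (fanoutFn_mem_FP idxF_mem_FP (comp_mem_FP (nthF_mem_FP 2) (nthF_mem_FP 0))))
/-- `bitZF ∈ FP`. [folklore] -/
theorem bitZF_mem_FP : bitZF ∈ FP :=
  comp_mem_FP headBitFn_mem_FP (comp_mem_FP dropFn_mem_FP (fanoutFn_mem_FP idxF_mem_FP (comp_mem_FP (sndPow_mem_FP 2) (nthF_mem_FP 0))))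
/-- `itemF ∈ FP`. [folklore] -/
theorem itemF_mem_FP : itemF ∈ FP :=
  iteFn_mem_FP bitWF_mem_FP (iteFn_mem_FP bitZF_mem_FP (const_mem_FP _) (const_mem_FP _))
    (iteFn_mem_FP bitZF_mem_FP (const_mem_FP _) (const_mem_FP _))
/-- `outBody ∈ FP`. [folklore] -/
theorem outBody_mem_FP : outBody ∈ FP :=
  fanoutFn_mem_FP (comp_mem_FP (cons_mem_FP true) (nthF_mem_FP 2))
    (comp_mem_FP concatFn_mem_FP (fanoutFn_mem_FP (sndPow_mem_FP 2) (fanoutFn_mem_FP itemF_mem_FP (const_mem_FP _))))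

/-- **Value of the code brick** on a well-formed record. [folklore] -/
theorem itemF_apply (M off w z cnt acc : List Bool) (j : ℕ) :
    itemF (boolPair (boolPair M (boolPair off (boolPair w z))) (boolPair cnt (boolPair (ones j) acc))) =
      codeOf w z (off.length + j) := by
  have hW : bitWF (boolPair (boolPair M (boolPair off (boolPair w z))) (boolPair cnt (boolPair (ones j) acc))) =
      [w.getD (off.length + j) false] := by
    simp [bitWF, idxF, nthF, ones]
  have hZ : bitZF (boolPair (boolPair M (boolPair off (boolPair w z))) (boolPair cnt (boolPair (ones j) acc))) =
      [z.getD (off.length + j) false] := by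
    simp [bitZF, idxF, nthF, sndPow, ones]
  rw [codeOf_eq]
  unfold itemF
  cases hw : w.getD (off.length + j) false <;> cases hz : z.getD (off.length + j) false
  · rw [iteFn_apply_false (by rw [hW, hw]), iteFn_apply_false (by rw [hZ, hz])]; simp
  · rw [iteFn_apply_false (by rw [hW, hw]), iteFn_apply_true (by rw [hZ, hz])]; simp
  · rw [iteFn_apply_true (by rw [hW, hw]), iteFn_apply_false (by rw [hZ, hz])]; simp
  · rw [iteFn_apply_true (by rw [hW, hw]), iteFn_apply_true (by rw [hZ, hz])]; simp

/-- **Value of one round** on a well-formed record. [folklore] -/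
theorem outBody_apply (M off w z cnt acc : List Bool) (j : ℕ) :
    outBody (boolPair (boolPair M (boolPair off (boolPair w z))) (boolPair cnt (boolPair (ones j) acc))) =
      boolPair (ones (j + 1)) (acc ++ frames [codeOf w z (off.length + j)]) := by
  simp only [outBody, fanoutFn_apply, Function.comp_apply, itemF_apply, frames_cons_eq_boolPair, frames_nil]
  simp [nthF, sndPow, ones, List.replicate_succ]

/-- `bitWF` is one-bit. [folklore] -/
theorem oneBit_bitWF : OneBit bitWF := oneBit_headBitFn.comp _

/-- `bitZF` is one-bit. [folklore] -/
theorem oneBit_bitZF : OneBit bitZF := oneBit_headBitFn.comp _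

/-- The code brick is short: `|itemF z| ≤ 5`. [folklore] -/
theorem length_itemF_le (r : List Bool) : (itemF r).length ≤ 5 := by
  unfold itemF
  rw [iteFn_of_oneBit oneBit_bitWF, iteFn_of_oneBit oneBit_bitZF, iteFn_of_oneBit oneBit_bitZF]
  split_ifs <;> simp

/-- **Growth of one round**: `|outBody z| ≤ |sndPow 1 z| + 16` on every record. [folklore] -/
theorem length_outBody_le (r : List Bool) :
    (outBody r).length ≤ (sndPow 1 r).length + 16 * ((fstF r).length + 1) := by
  have hst := length_nthF_succ_add_sndPow_succ_le 1 r
  have hit := length_itemF_le r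
  simp only [outBody, fanoutFn_apply, Function.comp_apply, length_boolPair, List.length_cons, List.length_append,
    concatFn_boolPair, List.length_nil]
  nlinarith

/-! ### The output loop and the run map -/

/-- The fixed field `X = ⟨1ᵐ, ⟨1^{n m t}, ⟨w, z⟩⟩⟩` of the output loop. [folklore] -/
def outX : List Bool → List Bool :=
  fanoutFn MF (fanoutFn (umulFn ∘ fanoutFn (umulFn ∘ fanoutFn NF MF) (tU ∘ NF)) (fanoutFn wF (zF A p)))

/-- The initial record `⟨X, ⟨encodeNat m, ⟨ε, ε⟩⟩⟩`. [folklore] -/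
def outInit : List Bool → List Bool := fanoutFn (outX A p) (fanoutFn (widthFn ∘ NF) fun _ => boolPair [] [])

/-- The counted loop of `outBody`, clocked at `|X| ≥ m` rounds. [folklore] -/
def outLoop (rec : List Bool) : List Bool := (loopStep outBody)^[(X : Polynomial ℕ).eval (fstF rec).length] rec

/-- **The run map of the solver as a string function** on `⟨inp, r⟩`:
`⟨encodeNat m, ⟨1ᵐ, accumulated codes⟩⟩`. [folklore] -/
def runFn : List Bool → List Bool := fanoutFn (widthFn ∘ NF) (fanoutFn MF (sndPow 2 ∘ outLoop ∘ outInit A p))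

/-- `outX A p ∈ FP`. [folklore] -/
theorem outX_mem_FP (hf : sisFunction_polyTimeComputable) (hA : IsPPT A id) : outX A p ∈ FP :=
  fanoutFn_mem_FP MF_mem_FP (fanoutFn_mem_FP
    (comp_mem_FP umulFn_mem_FP (fanoutFn_mem_FP (comp_mem_FP umulFn_mem_FP (fanoutFn_mem_FP NF_mem_FP MF_mem_FP)) (comp_mem_FP tU_mem_FP NF_mem_FP)))
    (fanoutFn_mem_FP wF_mem_FP (zF_mem_FP A p hf hA)))

/-- `outInit A p ∈ FP`. [folklore] -/
theorem outInit_mem_FP (hf : sisFunction_polyTimeComputable) (hA : IsPPT A id) : outInit A p ∈ FP :=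
  fanoutFn_mem_FP (outX_mem_FP A p hf hA) (fanoutFn_mem_FP (comp_mem_FP widthFn_mem_FP NF_mem_FP) (const_mem_FP _))

/-- `outLoop ∈ FP` (a counted loop with a body of constant growth). [folklore] -/
theorem outLoop_mem_FP : outLoop ∈ FP := loopFn_mem_FP outBody_mem_FP length_outBody_le X

/-- `runFn A p ∈ FP` for Ajtai's function polynomial-time and `A` PPT. [folklore] -/
theorem runFn_mem_FP (hf : sisFunction_polyTimeComputable) (hA : IsPPT A id) : runFn A p ∈ FP :=
  fanoutFn_mem_FP (comp_mem_FP widthFn_mem_FP NF_mem_FP) (fanoutFn_mem_FP MF_mem_FP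
    (comp_mem_FP (sndPow_mem_FP 2) (comp_mem_FP outLoop_mem_FP (outInit_mem_FP A p hf hA))))

/-- **The loop invariant of the output loop**: `k` rounds from `⟨1ʲ, acc⟩` append the frames of
the codes `j, …, j + k - 1`. [folklore] -/
theorem loopModel_outBody (M off w z : List Bool) : ∀ (k j : ℕ) (acc : List Bool),
    loopModel outBody (boolPair M (boolPair off (boolPair w z))) k (boolPair (ones j) acc) =
      boolPair (ones (j + k)) (acc ++ frames ((List.range' j k).map fun i => codeOf w z (off.length + i)))
  | 0, j, acc => by simp [loopModel]
  | k + 1, j, acc => by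
    rw [loopModel, outBody_apply, loopModel_outBody M off w z k (j + 1), List.range'_succ, List.map_cons,
      show j + 1 + k = j + (k + 1) by omega]
    simp [List.append_assoc]

/-- **`runFn A p ⟨inp, r⟩` is the run of the solver** `(SIS.sisSolver A (p ·)).run inp r`, on every
pair of strings. [folklore] -/
theorem runFn_apply (inp r : List Bool) :
    runFn A p (boolPair inp r) = (sisSolver A fun ℓ => p.eval ℓ).run inp r := by
  -- the right-hand side, unfolded
  have hrhs : (sisSolver A fun ℓ => p.eval ℓ).run inp r =
      encodeIntVec ⟨width (nOf inp), xOf (nOf inp) (queryOf inp r) -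
        xOf (nOf inp) (A.run (boolPair (unaryEncodeNat (queryOf inp r).length) (sisFunction (queryOf inp r)))
          ((r.drop (guessBits (nOf inp) + width (nOf inp) + blockLen (nOf inp) +
              lenBits (fun ℓ => p.eval ℓ) (nOf inp))).take (coinCountOf p inp r)))⟩ := by
    simp only [sisSolver, solverCoreK, queryOf, coinCountOf, bitsToNat_eq]
  rw [hrhs, encodeIntVec_xOf_sub]
  -- the left-hand side: initial record, loop, projections
  set n := nOf inp with hn
  set w := queryOf inp r with hw
  set z := A.run (boolPair (unaryEncodeNat w.length) (sisFunction w))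
    ((r.drop (guessBits n + width n + blockLen n + lenBits (fun ℓ => p.eval ℓ) n)).take (coinCountOf p inp r)) with hz
  have hX : outX A p (boolPair inp r) =
      boolPair (ones (width n)) (boolPair (ones (n * width n * bitWidth n)) (boolPair w z)) := by
    simp [outX, wF_apply, zF_apply, ones, hn, hw, hz]
  have hinit : outInit A p (boolPair inp r) =
      boolPair (boolPair (ones (width n)) (boolPair (ones (n * width n * bitWidth n)) (boolPair w z)))
        (boolPair (encodeNat (width n)) (boolPair [] [])) := by
    simp [outInit, hX, ones, hn, widthFn]
  have hrounds : width n ≤ (X : Polynomial ℕ).eval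
      (boolPair (ones (width n)) (boolPair (ones (n * width n * bitWidth n)) (boolPair w z))).length := by
    simp only [eval_X, length_boolPair, List.length_replicate]; omega
  have hloop := iterate_loopStep outBody
    (boolPair (ones (width n)) (boolPair (ones (n * width n * bitWidth n)) (boolPair w z))) _ _ (boolPair [] []) hrounds
  have hmodel := loopModel_outBody (ones (width n)) (ones (n * width n * bitWidth n)) w z (width n) 0 []
  simp only [runFn, fanoutFn_apply, Function.comp_apply, outLoop, hinit, fstF_boolPair, hloop]
  simp only [ones, List.replicate_zero, List.nil_append, zero_add, List.length_replicate] at hmodel ⊢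
  rw [hmodel]
  simp [hn, sndPow, List.range_eq_range', widthFn, ones, OracleCompose.unaryEncodeNat_eq_replicate]

end Literature.Computability.Cryptography.SIS.SolverFP

/-! ### The discharge -/

namespace Literature.Computability.Cryptography

open Literature.Computability.Complexity SIS SIS.SolverFP

/-- **Discharge of `sisSolver_polyTime`** (TM2 level): if Ajtai's function `SIS.sisFunction` is
polynomial-time computable then for every PPT inverter `A` and polynomial `p` the run map
`(inp, r) ↦ (SIS.sisSolver A (p ·)).run inp r` of the explicit SIS′ solver is polynomial-time
computable as a function of `⟨inp, r⟩` — it is the `FP` string function `SolverFP.runFn A p`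
(`runFn_apply`), transported along the pair presentation. [Micciancio–Regev 2007, §5.1; Ajtai
1996, Thm. 1; Arora–Barak 2009, §1.3 and Def. 7.1] [cite: AroraBarak2009, Def. 7.1 (with Claim 1.6 / Thm. 2.8)] -/
theorem sisSolver_polyTime_holds : sisSolver_polyTime := by
  intro hf A p hA
  exact PolyTimeComputable.of_encode_eq (f := SolverFP.runFn A p)
    (fun w : List Bool × List Bool => boolPair w.1 w.2) (fun _ => rfl)
    (fun w => by obtain ⟨a, b⟩ := w; exact SolverFP.runFn_apply A p a b) (SolverFP.runFn_mem_FP A p hf hA)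

end Literature.Computability.Cryptography


end
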